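import Mathlib
import Summits.Ventures.DiscreteObjects.Mahler.SubLehmerDegree56
import Summits.Ventures.DiscreteObjects.Mahler.LowDegreeMeasures

/-!
# Unit-measure factors: explicit cyclotomic polynomials have Mahler measure 1 (venture `DiscreteObjects`, target L)

Cell `pub-namedobj`, seat `pub-namedobj-mahler` (gen 11). Framing: lottery ticket; floor = certified
bounds/negative ranges.

Tool for verifying printed tables whose entries are "short" (non-irreducible) polynomials — a noncyclotomic core times
cyclotomic factors (McKee–Smyth Table D.1; file `McKeeSmythD1RowsA`): if `q · s = X^N − 1` in `ℤ[X]` then `M(q) = 1`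
(`M` multiplicative, `M ≥ 1` on nonzero integer polynomials, `M(X^N − 1) = 1`), and the explicit instances
`M(Φ_m) = 1` for the cyclotomic polynomials `Φ_m`, `m ∈ {1, 2, 3, 4, 5, 6, 7, 8, 9, 10, 12, 14, 15, 16, 18, 24}`, each written out as an integer
polynomial and certified by the identity `Φ_m · ((X^m − 1)/Φ_m) = X^m − 1` (`ring`), without identifying it with
Mathlib's `cyclotomic m ℤ`.
-/

namespace Summit.Ventures.DiscreteObjects.Mahler

open Polynomial

/-- `M(X^N - 1) = 1` for `N ≥ 1` (product of cyclotomic polynomials). -/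
theorem intMahlerMeasure_X_pow_sub_one {N : ℕ} (hN : 0 < N) : intMahlerMeasure (X ^ N - 1 : ℤ[X]) = 1 := by
  rw [← prod_cyclotomic_eq_X_pow_sub_one hN ℤ, Finset.prod_eq_multiset_prod, intMahlerMeasure_multiset_prod,
    Multiset.map_map]
  have : ((N.divisors.val).map (intMahlerMeasure ∘ fun i => cyclotomic i ℤ)) = (N.divisors.val).map fun _ => (1 : ℝ) :=
    Multiset.map_congr rfl fun i _ => intMahlerMeasure_cyclotomic i
  rw [this, Multiset.map_const', Multiset.prod_replicate, one_pow]

/-- **If `q · s = X^N − 1` then `M(q) = 1`.** -/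
theorem intMahlerMeasure_eq_one_of_mul_eq_X_pow_sub_one {q s : ℤ[X]} {N : ℕ} (hN : 0 < N)
    (h : q * s = X ^ N - 1) : intMahlerMeasure q = 1 := by
  have hne : (X ^ N - 1 : ℤ[X]) ≠ 0 := by
    rw [show (X ^ N - 1 : ℤ[X]) = X ^ N - C 1 by rw [map_one]]
    exact X_pow_sub_C_ne_zero hN 1
  have hq : q ≠ 0 := by intro h0; rw [h0, zero_mul] at h; exact hne h.symm
  have hs : s ≠ 0 := by intro h0; rw [h0, mul_zero] at h; exact hne h.symm
  have hm := intMahlerMeasure_mul q s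
  rw [h, intMahlerMeasure_X_pow_sub_one hN] at hm
  have h1 := one_le_intMahlerMeasure hq
  have h2 := one_le_intMahlerMeasure hs
  nlinarith

/-- `M(Φ_1) = 1`, `Φ_1 = X - 1`. -/
theorem cycloFactor1_measure : intMahlerMeasure (X - 1 : ℤ[X]) = 1 :=
  intMahlerMeasure_eq_one_of_mul_eq_X_pow_sub_one (N := 1) (s := (1 : ℤ[X])) (by norm_num) (by ring)

/-- `M(Φ_2) = 1`, `Φ_2 = X + 1`. -/
theorem cycloFactor2_measure : intMahlerMeasure (X + 1 : ℤ[X]) = 1 :=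
  intMahlerMeasure_eq_one_of_mul_eq_X_pow_sub_one (N := 2) (s := (X - 1 : ℤ[X])) (by norm_num) (by ring)

/-- `M(Φ_3) = 1`, `Φ_3 = X ^ 2 + X + 1`. -/
theorem cycloFactor3_measure : intMahlerMeasure (X ^ 2 + X + 1 : ℤ[X]) = 1 :=
  intMahlerMeasure_eq_one_of_mul_eq_X_pow_sub_one (N := 3) (s := (X - 1 : ℤ[X])) (by norm_num) (by ring)

/-- `M(Φ_4) = 1`, `Φ_4 = X ^ 2 + 1`. -/
theorem cycloFactor4_measure : intMahlerMeasure (X ^ 2 + 1 : ℤ[X]) = 1 :=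
  intMahlerMeasure_eq_one_of_mul_eq_X_pow_sub_one (N := 4) (s := (X ^ 2 - 1 : ℤ[X])) (by norm_num) (by ring)

/-- `M(Φ_5) = 1`, `Φ_5 = X ^ 4 + X ^ 3 + X ^ 2 + X + 1`. -/
theorem cycloFactor5_measure : intMahlerMeasure (X ^ 4 + X ^ 3 + X ^ 2 + X + 1 : ℤ[X]) = 1 :=
  intMahlerMeasure_eq_one_of_mul_eq_X_pow_sub_one (N := 5) (s := (X - 1 : ℤ[X])) (by norm_num) (by ring)

/-- `M(Φ_6) = 1`, `Φ_6 = X ^ 2 - X + 1`. -/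
theorem cycloFactor6_measure : intMahlerMeasure (X ^ 2 - X + 1 : ℤ[X]) = 1 :=
  intMahlerMeasure_eq_one_of_mul_eq_X_pow_sub_one (N := 6) (s := (X ^ 4 + X ^ 3 - X - 1 : ℤ[X])) (by norm_num) (by ring)

/-- `M(Φ_7) = 1`, `Φ_7 = X ^ 6 + X ^ 5 + X ^ 4 + X ^ 3 + X ^ 2 + X + 1`. -/
theorem cycloFactor7_measure : intMahlerMeasure (X ^ 6 + X ^ 5 + X ^ 4 + X ^ 3 + X ^ 2 + X + 1 : ℤ[X]) = 1 :=
  intMahlerMeasure_eq_one_of_mul_eq_X_pow_sub_one (N := 7) (s := (X - 1 : ℤ[X])) (by norm_num) (by ring)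

/-- `M(Φ_8) = 1`, `Φ_8 = X ^ 4 + 1`. -/
theorem cycloFactor8_measure : intMahlerMeasure (X ^ 4 + 1 : ℤ[X]) = 1 :=
  intMahlerMeasure_eq_one_of_mul_eq_X_pow_sub_one (N := 8) (s := (X ^ 4 - 1 : ℤ[X])) (by norm_num) (by ring)

/-- `M(Φ_9) = 1`, `Φ_9 = X ^ 6 + X ^ 3 + 1`. -/
theorem cycloFactor9_measure : intMahlerMeasure (X ^ 6 + X ^ 3 + 1 : ℤ[X]) = 1 :=
  intMahlerMeasure_eq_one_of_mul_eq_X_pow_sub_one (N := 9) (s := (X ^ 3 - 1 : ℤ[X])) (by norm_num) (by ring)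

/-- `M(Φ_10) = 1`, `Φ_10 = X ^ 4 - X ^ 3 + X ^ 2 - X + 1`. -/
theorem cycloFactor10_measure : intMahlerMeasure (X ^ 4 - X ^ 3 + X ^ 2 - X + 1 : ℤ[X]) = 1 :=
  intMahlerMeasure_eq_one_of_mul_eq_X_pow_sub_one (N := 10) (s := (X ^ 6 + X ^ 5 - X - 1 : ℤ[X])) (by norm_num) (by ring)

/-- `M(Φ_12) = 1`, `Φ_12 = X ^ 4 - X ^ 2 + 1`. -/
theorem cycloFactor12_measure : intMahlerMeasure (X ^ 4 - X ^ 2 + 1 : ℤ[X]) = 1 :=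
  intMahlerMeasure_eq_one_of_mul_eq_X_pow_sub_one (N := 12) (s := (X ^ 8 + X ^ 6 - X ^ 2 - 1 : ℤ[X])) (by norm_num) (by ring)

/-- `M(Φ_14) = 1`, `Φ_14 = X ^ 6 - X ^ 5 + X ^ 4 - X ^ 3 + X ^ 2 - X + 1`. -/
theorem cycloFactor14_measure : intMahlerMeasure (X ^ 6 - X ^ 5 + X ^ 4 - X ^ 3 + X ^ 2 - X + 1 : ℤ[X]) = 1 :=
  intMahlerMeasure_eq_one_of_mul_eq_X_pow_sub_one (N := 14) (s := (X ^ 8 + X ^ 7 - X - 1 : ℤ[X])) (by norm_num) (by ring)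

/-- `M(Φ_15) = 1`, `Φ_15 = X ^ 8 - X ^ 7 + X ^ 5 - X ^ 4 + X ^ 3 - X + 1`. -/
theorem cycloFactor15_measure : intMahlerMeasure (X ^ 8 - X ^ 7 + X ^ 5 - X ^ 4 + X ^ 3 - X + 1 : ℤ[X]) = 1 :=
  intMahlerMeasure_eq_one_of_mul_eq_X_pow_sub_one (N := 15) (s := (X ^ 7 + X ^ 6 + X ^ 5 - X ^ 2 - X - 1 : ℤ[X])) (by norm_num) (by ring)

/-- `M(Φ_16) = 1`, `Φ_16 = X ^ 8 + 1`. -/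
theorem cycloFactor16_measure : intMahlerMeasure (X ^ 8 + 1 : ℤ[X]) = 1 :=
  intMahlerMeasure_eq_one_of_mul_eq_X_pow_sub_one (N := 16) (s := (X ^ 8 - 1 : ℤ[X])) (by norm_num) (by ring)

/-- `M(Φ_18) = 1`, `Φ_18 = X ^ 6 - X ^ 3 + 1`. -/
theorem cycloFactor18_measure : intMahlerMeasure (X ^ 6 - X ^ 3 + 1 : ℤ[X]) = 1 :=
  intMahlerMeasure_eq_one_of_mul_eq_X_pow_sub_one (N := 18) (s := (X ^ 12 + X ^ 9 - X ^ 3 - 1 : ℤ[X])) (by norm_num) (by ring)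

/-- `M(Φ_24) = 1`, `Φ_24 = X ^ 8 - X ^ 4 + 1`. -/
theorem cycloFactor24_measure : intMahlerMeasure (X ^ 8 - X ^ 4 + 1 : ℤ[X]) = 1 :=
  intMahlerMeasure_eq_one_of_mul_eq_X_pow_sub_one (N := 24) (s := (X ^ 16 + X ^ 12 - X ^ 4 - 1 : ℤ[X])) (by norm_num) (by ring)

end Summit.Ventures.DiscreteObjects.Mahler
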